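import Summits.SmoothPoincare4.SmoothPoincare4.Theorems.EntropyRungConicalGapRicciMomentIdentity
import Literature.Geometry.Lorentzian.DalembertianCompose
import HarnessLib

/-!
# Helper `helper_firstOrderTestIdentity` of line `Sketch`
(crux `EntropyRung.ConicalGap`, stmt-SmoothPoincare4-16589; cycle 5, localisation)

The **first-order test-function identity** (the general test-function form of the Wang–Wang
identity `∫ (f − 2τ) e^{-f/τ} dV = (1 − τ) ∫ R e^{-f/τ} dV`, `n = 4`): on a complete connected
normalised gradient shrinking Ricci soliton `(M⁴, g, f)` (`Ric + Hess f = g/2`, `R + |∇f|² = f`,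
closed `g`-balls compact), for every `η ∈ C¹(ℝ)` with `η`, `η′` bounded and every `τ > 0`,

  `∫ e^{-f/τ} η(f) (f − 2τ + (τ − 1) R) dV = τ ∫ e^{-f/τ} η′(f) (f − R) dV`,

both integrands being integrable (`η ≡ 1` is Wang–Wang; a smooth step `η` localises the identity to
the core / the end of the soliton). This is Green's first identity along the proper exhaustion `f`,
`∫ u Δ w dV = −∫ g⁻¹(du, dw) dV`
(`CarrilloNi2009_shrinkerLSI.integral_mul_dalembertian_eq_neg_integral_innerDual_of_proper`), with
`u = η ∘ f ∈ C¹` and `w = e^{-f/τ} ∈ C²`: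

* pointwise `Δ w = τ⁻² w (f − τ n/2 + (τ − 1) R)` (`weightedIdentity_dalembertian_expNegDiv`),
  `g⁻¹(dρ, dw) = −τ⁻¹ w g⁻¹(dρ, df)` (`weightedIdentity_innerDual_mvfderiv_expNegDiv`), the chain
  rule `du = η′(f) df` (`mvfderiv_real_comp_apply`) and `g⁻¹(df, df) = |∇f|² = f − R`;
* the three integrability provisos of the Green identity are the weights `e^{-f/τ}`, `f e^{-f/τ}`,
  `R e^{-f/τ}` (`weightedIntegrability_riemVolume`) times the bounded continuous factors `η(f)`,
  `η′(f)`;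
* properness of `f` and `R ≥ 0`:
  `NoncompactShrinkerGapCarrilloNiClauses.scalarCurvature_nonneg_and_isCompact_sublevel`.

Hence `τ⁻² ∫ η(f) w (f − τ n/2 + (τ − 1) R) = τ⁻¹ ∫ η′(f) w (f − R)`; multiply by `τ²`.
The general-dimension statement is `firstOrderTestIdentity_riemVolume`; the registered helper is its
case `n = 4` over the Riemannian measure (`riemVolume_eq`).

Everything here is proved; no definition and no named fact is introduced.

## References

* Y. Wang, G. Wang (Wang–Wang 2023), arXiv:2308.06560, Prop. 2.6, (2.7)–(2.10).
* [CarrilloNi2009] J. Carrillo, L. Ni, Comm. Anal. Geom. 17 (2009) 721–753, §4.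
-/

noncomputable section

-- `Summit.SmoothPoincare4.SmoothPoincare4.…` (summit = problem) trips `dupNamespace` on every decl.
set_option linter.dupNamespace false

open scoped Manifold ContDiff ENNReal NNReal Topology
open MeasureTheory Set Filter
open Literature.Geometry.Lorentzian Literature.Geometry.Riemannian

namespace Summit.SmoothPoincare4.SmoothPoincare4.Theorems.ConicalGapSketch

/-! ## The identity on a proper normalised shrinker (any dimension) -/

section ProperGreen

variable {n : ℕ} {M : Type*} [TopologicalSpace M] [ChartedSpace (EuclideanSpace ℝ (Fin n)) M]
  [IsManifold (𝓡 n) ∞ M] [T3Space M] [MeasurableSpace M] [BorelSpace M]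
  {g : PseudoRiemannianMetric (𝓡 n) ∞ (EuclideanSpace ℝ (Fin n)) (TangentSpace (𝓡 n) : M → Type _)}
  {f : M → ℝ}

/-- **A bounded continuous function of the potential times an integrable weight is integrable**:
for `θ : ℝ → ℝ` continuous with `|θ| ≤ C` and `W ∈ L¹(g.riemVolume)`, `θ(f) W ∈ L¹(g.riemVolume)`
(`Integrable.bdd_mul`). -/
theorem firstOrderTestIdentity_integrable_bdd_mul (hf : ContMDiff (𝓡 n) 𝓘(ℝ, ℝ) ∞ f)
    {θ : ℝ → ℝ} {C : ℝ} (hθ : Continuous θ) (hbd : ∀ r, |θ r| ≤ C) {W : M → ℝ}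
    (hW : Integrable W g.riemVolume) :
    Integrable (fun x ↦ θ (f x) * W x) g.riemVolume :=
  hW.bdd_mul (show Continuous fun x ↦ θ (f x) from hθ.comp hf.continuous).aestronglyMeasurable
    (Eventually.of_forall fun _ ↦ (Real.norm_eq_abs _).trans_le (hbd _))

variable [g.HasLeviCivita]

/-- **The first-order test-function identity, any dimension, over `g.riemVolume`**: on a gradient
shrinker `Ric + Hess f = g/2` normalised by `R + |∇f|² = f`, with proper potential and `R ≥ 0`, for
every `η ∈ C¹(ℝ)` with `|η|, |η′| ≤ C` and every `τ > 0`, the integrands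
`e^{-f/τ} η(f) (f − τ n/2 + (τ − 1) R)` and `e^{-f/τ} η′(f) (f − R)` are integrable and
`∫ e^{-f/τ} η(f) (f − τ n/2 + (τ − 1) R) dV = τ ∫ e^{-f/τ} η′(f) (f − R) dV`:
Green's first identity along the proper exhaustion `f`
(`CarrilloNi2009_shrinkerLSI.integral_mul_dalembertian_eq_neg_integral_innerDual_of_proper`) with
`u = η ∘ f`, `w = e^{-f/τ}`, expanded by `Δ w = τ⁻² w (f − τ n/2 + (τ − 1) R)`
(`weightedIdentity_dalembertian_expNegDiv`), `g⁻¹(du, dw) = −τ⁻¹ w η′(f) (f − R)`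
(`mvfderiv_real_comp_apply`, `weightedIdentity_innerDual_mvfderiv_expNegDiv`, `|∇f|² = f − R`),
the provisos being the weights of `weightedIntegrability_riemVolume` times bounded factors. -/
theorem firstOrderTestIdentity_riemVolume (hg : g.IsRiemannian)
    (hf : ContMDiff (𝓡 n) 𝓘(ℝ, ℝ) ∞ f)
    (hsol : ∀ (x : M) (X Y : TangentSpace (𝓡 n) x),
      g.ricci x X Y + g.hessian f x X Y = (1 / 2 : ℝ) * g.val x X Y)
    (hnorm : ∀ x : M, g.scalarCurvature x + g.gradSq f x = f x)
    (hprop : ∀ R : ℝ, IsCompact {x | f x ≤ R}) (hR0 : ∀ x, 0 ≤ g.scalarCurvature x)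
    {η : ℝ → ℝ} {C : ℝ} (hη : ContDiff ℝ 1 η) (hb : ∀ r, |η r| ≤ C)
    (hb' : ∀ r, |deriv η r| ≤ C) {τ : ℝ} (hτ : 0 < τ) :
    Integrable (fun x ↦ Real.exp (-f x / τ) * η (f x) *
        (f x - τ * n / 2 + (τ - 1) * g.scalarCurvature x)) g.riemVolume ∧
      Integrable (fun x ↦ Real.exp (-f x / τ) * deriv η (f x) * (f x - g.scalarCurvature x))
        g.riemVolume ∧
      ∫ x, Real.exp (-f x / τ) * η (f x) * (f x - τ * n / 2 + (τ - 1) * g.scalarCurvature x)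
          ∂g.riemVolume =
        τ * ∫ x, Real.exp (-f x / τ) * deriv η (f x) * (f x - g.scalarCurvature x)
          ∂g.riemVolume := by
  obtain ⟨iE, iF, iR⟩ := weightedIntegrability_riemVolume hg hf hsol hnorm hprop hR0 hτ
  have hτ0 : τ ≠ 0 := hτ.ne'
  -- the test factors `η ∘ f`, `η′ ∘ f`
  have hηc : Continuous η := hη.continuous
  have hη'c : Continuous (deriv η) := hη.continuous_deriv le_rfl
  have hηd : ∀ t, HasDerivAt η (deriv η t) t := fun t ↦
    (hη.differentiable one_ne_zero t).hasDerivAt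
  -- the weights `e^{-f/τ} (f − τ n/2 + (τ − 1) R)` and `e^{-f/τ} (f − R)` are integrable
  have iW1 : Integrable (fun x ↦ Real.exp (-f x / τ) *
      (f x - τ * n / 2 + (τ - 1) * g.scalarCurvature x)) g.riemVolume :=
    ((iF.sub (iE.const_mul (τ * n / 2))).add (iR.const_mul (τ - 1))).congr
      (Eventually.of_forall fun x ↦ by simp only [Pi.add_apply, Pi.sub_apply]; ring)
  have iW2 : Integrable (fun x ↦ Real.exp (-f x / τ) * (f x - g.scalarCurvature x))
      g.riemVolume :=
    (iF.sub iR).congr (Eventually.of_forall fun x ↦ by simp only [Pi.sub_apply]; ring)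
  -- the integrands of the statement and of the provisos
  have i1 : Integrable (fun x ↦ Real.exp (-f x / τ) * η (f x) *
      (f x - τ * n / 2 + (τ - 1) * g.scalarCurvature x)) g.riemVolume :=
    (firstOrderTestIdentity_integrable_bdd_mul hf hηc hb iW1).congr
      (Eventually.of_forall fun x ↦ by ring)
  have i2 : Integrable (fun x ↦ Real.exp (-f x / τ) * deriv η (f x) *
      (f x - g.scalarCurvature x)) g.riemVolume :=
    (firstOrderTestIdentity_integrable_bdd_mul hf hη'c hb' iW2).congr
      (Eventually.of_forall fun x ↦ by ring)
  have i3 : Integrable (fun x ↦ Real.exp (-f x / τ) * η (f x) *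
      (f x - g.scalarCurvature x)) g.riemVolume :=
    (firstOrderTestIdentity_integrable_bdd_mul hf hηc hb iW2).congr
      (Eventually.of_forall fun x ↦ by ring)
  refine ⟨i1, i2, ?_⟩
  -- regularity: `η ∘ f ∈ C¹`, `e^{-f/τ} ∈ C²`
  have hu1 : ContMDiff (𝓡 n) 𝓘(ℝ, ℝ) 1 (fun y ↦ η (f y)) :=
    hη.comp_contMDiff (hf.of_le ENat.LEInfty.out)
  have hw : ContMDiff (𝓡 n) 𝓘(ℝ, ℝ) 2 (fun y ↦ Real.exp (-f y / τ)) :=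
    ((Real.contDiff_exp.comp (contDiff_neg.div_const τ)).comp_contMDiff hf).of_le ENat.LEInfty.out
  have hfx : ∀ x, MDifferentiableAt (𝓡 n) 𝓘(ℝ, ℝ) f x := fun x ↦
    hf.mdifferentiableAt (by norm_num)
  -- `g⁻¹(df, df) = |∇f|² = f − R`
  have hgrad : ∀ x, g.innerDual x (mvfderiv (𝓡 n) f x).toLinearMap
      (mvfderiv (𝓡 n) f x).toLinearMap = f x - g.scalarCurvature x := fun x ↦ by
    rw [show g.innerDual x (mvfderiv (𝓡 n) f x).toLinearMap (mvfderiv (𝓡 n) f x).toLinearMap =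
      g.gradSq f x from rfl]
    linarith [hnorm x]
  -- pointwise `η(f) Δ(e^{-f/τ}) = τ⁻² e^{-f/τ} η(f) (f − τ n/2 + (τ − 1) R)`
  have hpt : ∀ x, η (f x) * g.dalembertian (fun y ↦ Real.exp (-f y / τ)) x =
      (τ ^ 2)⁻¹ * (Real.exp (-f x / τ) * η (f x) *
        (f x - τ * n / 2 + (τ - 1) * g.scalarCurvature x)) := fun x ↦ by
    rw [weightedIdentity_dalembertian_expNegDiv hsol hnorm hf τ x]
    field_simp
    ring
  have huΔ : Integrable (fun x ↦ η (f x) *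
      g.dalembertian (fun y ↦ Real.exp (-f y / τ)) x) g.riemVolume :=
    (i1.const_mul _).congr (Eventually.of_forall fun x ↦ (hpt x).symm)
  -- the chain rule `d(η ∘ f) = η′(f) df` inside the inverse metric
  have hdu : ∀ x, (mvfderiv (𝓡 n) (fun y ↦ η (f y)) x).toLinearMap =
      (deriv η (f x)) • (mvfderiv (𝓡 n) f x).toLinearMap := fun x ↦ by
    ext v
    have := mvfderiv_real_comp_apply (I := 𝓡 n) (hηd (f x)) (hfx x) v
    simpa [Function.comp_def] using this
  have hsmul : ∀ (x : M) (c : ℝ) (α β : Module.Dual ℝ (TangentSpace (𝓡 n) x)),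
      g.innerDual x (c • α) β = c * g.innerDual x α β := fun x c α β ↦ by
    simp only [PseudoRiemannianMetric.innerDual, LinearMap.smul_apply, smul_eq_mul]
  -- pointwise `g⁻¹(d(η ∘ f), d e^{-f/τ}) = -τ⁻¹ e^{-f/τ} η′(f) (f − R)`
  have hduw_pt : ∀ x, g.innerDual x (mvfderiv (𝓡 n) (fun y ↦ η (f y)) x).toLinearMap
      (mvfderiv (𝓡 n) (fun y ↦ Real.exp (-f y / τ)) x).toLinearMap =
      -τ⁻¹ * (Real.exp (-f x / τ) * deriv η (f x) * (f x - g.scalarCurvature x)) := fun x ↦ by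
    rw [weightedIdentity_innerDual_mvfderiv_expNegDiv τ (hfx x), hdu x, hsmul, hgrad x]
    ring
  have hduw : Integrable (fun x ↦ g.innerDual x
      (mvfderiv (𝓡 n) (fun y ↦ η (f y)) x).toLinearMap
      (mvfderiv (𝓡 n) (fun y ↦ Real.exp (-f y / τ)) x).toLinearMap) g.riemVolume :=
    (i2.const_mul (-τ⁻¹)).congr (Eventually.of_forall fun x ↦ (hduw_pt x).symm)
  -- pointwise `η(f) g⁻¹(df, d e^{-f/τ}) = -τ⁻¹ e^{-f/τ} η(f) (f − R)`
  have hcross_pt : ∀ x, η (f x) * g.innerDual x (mvfderiv (𝓡 n) f x).toLinearMap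
      (mvfderiv (𝓡 n) (fun y ↦ Real.exp (-f y / τ)) x).toLinearMap =
      -τ⁻¹ * (Real.exp (-f x / τ) * η (f x) * (f x - g.scalarCurvature x)) := fun x ↦ by
    rw [weightedIdentity_innerDual_mvfderiv_expNegDiv τ (hfx x), hgrad x]
    ring
  have hcross : Integrable (fun x ↦ η (f x) * g.innerDual x
      (mvfderiv (𝓡 n) f x).toLinearMap
      (mvfderiv (𝓡 n) (fun y ↦ Real.exp (-f y / τ)) x).toLinearMap) g.riemVolume :=
    (i3.const_mul (-τ⁻¹)).congr (Eventually.of_forall fun x ↦ (hcross_pt x).symm)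
  -- Green's first identity along the exhaustion `f`
  have hG :=
    CarrilloNi2009_shrinkerLSI.integral_mul_dalembertian_eq_neg_integral_innerDual_of_proper hg hf
      hprop hu1 hw huΔ hduw hcross
  -- evaluate both sides
  have hI1 : ∫ x, η (f x) * g.dalembertian (fun y ↦ Real.exp (-f y / τ)) x ∂g.riemVolume =
      (τ ^ 2)⁻¹ * ∫ x, Real.exp (-f x / τ) * η (f x) *
        (f x - τ * n / 2 + (τ - 1) * g.scalarCurvature x) ∂g.riemVolume := by
    simp_rw [hpt]
    exact integral_const_mul _ _
  have hI2 : ∫ x, g.innerDual x (mvfderiv (𝓡 n) (fun y ↦ η (f y)) x).toLinearMap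
      (mvfderiv (𝓡 n) (fun y ↦ Real.exp (-f y / τ)) x).toLinearMap ∂g.riemVolume =
      -τ⁻¹ * ∫ x, Real.exp (-f x / τ) * deriv η (f x) * (f x - g.scalarCurvature x)
        ∂g.riemVolume := by
    simp_rw [hduw_pt]
    exact integral_const_mul _ _
  rw [hI1, hI2] at hG
  have h1 : τ ^ 2 * (τ ^ 2)⁻¹ = 1 := mul_inv_cancel₀ (pow_ne_zero 2 hτ0)
  have h2 : τ * τ⁻¹ = 1 := mul_inv_cancel₀ hτ0
  linear_combination τ ^ 2 * hG -
    (∫ x, Real.exp (-f x / τ) * η (f x) *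
      (f x - τ * n / 2 + (τ - 1) * g.scalarCurvature x) ∂g.riemVolume) * h1 +
    τ * (∫ x, Real.exp (-f x / τ) * deriv η (f x) * (f x - g.scalarCurvature x)
      ∂g.riemVolume) * h2

end ProperGreen

/-! ## The registered helper (n = 4) -/

/-- **Helper `helper_firstOrderTestIdentity` of line `Sketch`** (the first-order test-function
identity, `n = 4`): on every complete connected normalised 4-d gradient shrinking Ricci soliton, for
every `η ∈ C¹(ℝ)` with `|η|, |η′| ≤ C` and every `τ > 0`, the integrands
`e^{-f/τ} η(f) (f − 2τ + (τ − 1) R)` and `e^{-f/τ} η′(f) (f − R)` are `dV`-integrable and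
`∫ e^{-f/τ} η(f) (f − 2τ + (τ − 1) R) dV = τ ∫ e^{-f/τ} η′(f) (f − R) dV` (`dV` the Riemannian
measure of `g.toContMDiffRiemannianMetric hg`, to which `g.riemVolume` unfolds by `riemVolume_eq`;
`η ≡ 1` is the Wang–Wang identity `stub_weightedIdentity`): `firstOrderTestIdentity_riemVolume` at
`n = 4`, properness of `f` and `R ≥ 0` by
`NoncompactShrinkerGapCarrilloNiClauses.scalarCurvature_nonneg_and_isCompact_sublevel`. -/
theorem helper_firstOrderTestIdentity : ∀ (M : Type) [TopologicalSpace M] [T2Space M] [SecondCountableTopology M] [ChartedSpace (EuclideanSpace ℝ (Fin 4)) M] [IsManifold (𝓡 4) ∞ M] [ConnectedSpace M] [T3Space M] [MeasurableSpace M] [BorelSpace M] (g : Literature.Geometry.Lorentzian.PseudoRiemannianMetric (𝓡 4) ∞ (EuclideanSpace ℝ (Fin 4)) (TangentSpace (𝓡 4) : M → Type _)) [g.HasLeviCivita] (f : M → ℝ) (hg : g.IsRiemannian), (∀ (x : M) (r : NNReal), IsCompact {y : M | g.edist hg x y ≤ r}) → ContMDiff (𝓡 4) 𝓘(ℝ,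 ℝ) ∞ f → (∀ (x : M) (X Y : TangentSpace (𝓡 4) x), g.ricci x X Y + g.hessian f x X Y = (1 / 2 : ℝ) * g.val x X Y) → (∀ x : M, g.scalarCurvature x + g.gradSq f x = f x) → ∀ (η : ℝ → ℝ) (C : ℝ), ContDiff ℝ 1 η → (∀ r, |η r| ≤ C) → (∀ r, |deriv η r| ≤ C) → ∀ τ : ℝ, 0 < τ → MeasureTheory.Integrable (fun x ↦ Real.exp (-f x / τ) * η (f x) * (f x - 2 * τ + (τ - 1) * g.scalarCurvature x)) (Literature.Geometry.Lorentzian.riemannianMeasure (g.toContMDiffRiemannianMetric hg)) ∧ MeasureTheory.Integrable (fun x ↦ Real.exp (-f x / τ) * deriv η (f x) * (f x - g.scalarCurvature x)) (Literature.Geometry.Lorentzian.riemannianMeasure (g.toContMDiffRiemannianMetric hg)) ∧ ∫ x, Real.exp (-f x / τ) * η (f x) * (f x - 2 * τ + (τ - 1) * g.scalarCurvature x) ∂(Literature.Geometry.Lorentzian.riemannianMeasure (g.toContMDiffRiemannianMetric hg)) = τ * ∫ x, Real.exp (-f x / τ) * deriv η (f x) * (f x - g.scalarCurvature x) ∂(Literature.Geometry.Lorentzian.riemannianMeasure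 (g.toContMDiffRiemannianMetric hg)) := by
  intro M _ _ _ _ _ _ _ _ _ g _ f hg hc hf hsol hnorm η C hη hb hb' τ hτ
  obtain ⟨hR0, -, hprop⟩ :=
    NoncompactShrinkerGapCarrilloNiClauses.scalarCurvature_nonneg_and_isCompact_sublevel g f hg hc hf
      hsol hnorm
  have h := firstOrderTestIdentity_riemVolume hg hf hsol hnorm hprop hR0 hη hb hb' hτ
  have key : ∀ x, f x - τ * ((4 : ℕ) : ℝ) / 2 + (τ - 1) * g.scalarCurvature x =
      f x - 2 * τ + (τ - 1) * g.scalarCurvature x := fun x ↦ by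
    push_cast
    ring
  simp only [key] at h
  rw [← PseudoRiemannianMetric.riemVolume_eq hg]
  exact h

end Summit.SmoothPoincare4.SmoothPoincare4.Theorems.ConicalGapSketch

end
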